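import Summits.BirchSwinnertonDyer.BirchSwinnertonDyer.Theorems.KimAtThreeFineKatoLocalExactness
import Summits.BirchSwinnertonDyer.Rank1Residual.GaloisImage.PropagatedStructureKummer
import Summits.BirchSwinnertonDyer.Rank1Residual.GaloisImage.PropagatedConditionTopOfNoTorsionThree
import Summits.BirchSwinnertonDyer.Rank1Residual.GaloisImage.TorsionReductionOfLe
import Summits.BirchSwinnertonDyer.BirchSwinnertonDyer.Theorems.KimAtThreeFineKatoSATPointsRat
import Summits.BirchSwinnertonDyer.Rank1Residual.GaloisImage.LocalThreeTorsionAdicCompletion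
import Literature.NumberTheory.EllipticCurves.TorsionFrobeniusProofs
import HarnessLib

/-!
# Lemma L, GALOIS side, at `ℚ₃`: the finite-level functionals `Λfin_j = (exp*_ω ∘ lift) mod 3^{j+1}`
# and clause (i) of the (P-EXP) rider `KatoExpStarFiniteLevelAt` for them — clause (C1.b) of the
# fine Kato package ⟨C1⟩ = `stub_fineKato` of crux `KatoKuriharaPortThreeShared`
# (stmt-BirchSwinnertonDyer-19560), IN THE KERNEL MODULO the two PUBLISHED facts [BK90] Prop. 3.8 /
# Ex. 3.11 and Tate local duality, displayed in lattice form for an ABSTRACT scalar dual exponential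
# (cell `bsd-addord`, seat kim3 gen 13; route W2 `KimAtThreeKolyvagin`; `--supports 19560`, helper)

HONEST FRAMING. TOOL theorems only (no definition, no named fact, no `sorry`); closes nothing;
nothing is booked; BSD is not proved by any of this.  The scalar Bloch–Kato dual exponential
`exp*_ω : H¹(ℚ₃, T₃E) → ℚ₃` in the Néron coordinate is NOT constructed here: it is an arbitrary
additive map `φ` (section variable).  The tree now DEFINES `exp*` (p485577
`Literature/NumberTheory/PAdicHodge/BlochKatoDualExponential.lean`:
`PeriodRingData.dualExpClassCoord (bdRPeriodRingData hp) (logCyclotomic 3) ρ ω_dR`), but its elliptic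
coordinate needs the datum `ω_dR ∈ D⁰_dR(V₃E)` (definition item `defn-EllipticNeronDeRhamClass`, OPEN)
and local-field instances for `v₃.adicCompletion ℚ`; the day both exist, `φ := exp*_ω ∘ (T₃E → V₃E)`
instantiates every theorem below, and the two displayed hypotheses become the CITE facts the planner
files in that currency (consumer spec kim3 g12, (S5)):

* `hker` — **[BK90] Prop. 3.8 / Ex. 3.11** (with `H¹_f(K, T_pE) = E(K) ⊗ ℤ_p`, Rubin *Euler Systems*
  Prop. 1.6.8) in lattice form: `exp*_ω(y) = 0 ⟺` every finite-level image `π_{j+1,*} y ∈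
  H¹(ℚ_{v₃}, E[3^j·3])` is a local Kummer class (`W.kummerSelmerStructure`), i.e. `ker exp*_ω = H¹_f`;
* `hdual` — **Tate local duality + [BK90] Prop. 3.8** in lattice form: `a ∈ exp*_ω(H¹(ℚ₃, T₃E)) ⟺
  ∀ P ∈ E(ℚ₃), a · log_ω(P) ∈ ℤ₃` (`exp*_ω(H¹) = (log_ω E(ℚ₃))^∨`, from `⟨x, δP⟩ = exp*_ω(x)·log_ω(P)`),
  `log_ω` = n1011's `LocalLog.padicLog (W.baseChange ℚ_[3])`.

## What is proved (kim3 memo KIM3-W2-C1-g11 §2.2 "Lemma L ⇒ (C1.b)", in the kernel)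

§1 = sibling `KimAtThreeFineKatoLocalExactness` (`ker π_{k+1,*} ⊆ p^{k+1}·H¹(ℚ_v, T_pE)`, any `p`).
§2 (any `p, v, k`; `φ : H¹(ℚ_v, T_pE) →+ ℚ_p` abstract): `toZModPow_eq_of_tateLocalMap_eq`
(well-definedness of `exp*_ω mod p^{k+1}` on `𝓕_can(v)`); **`exists_functional_tateLocalMap_eq`** — if
`exp*_ω` is integral and `π_{k+1,*}` is onto there IS `Λ_k : H¹(ℚ_v, E[p^k·p]) →+ ℤ/p^{k+1}` with the
INTERFACE `exp*_ω(y) = s ∈ ℤ_p ⇒ Λ_k(π_{k+1,*} y) = s mod p^{k+1}`; and for ANY `Λ_k` with that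
interface: `exists_mem_propagated_apply_eq` (clause (i-a): onto `ℤ/p^{k+1}` on `𝓕_can(v)`, from
`exp*_ω(H¹) ⊇ ℤ_p`), **`apply_eq_zero_iff_mem_kummer`** (clause (i-b): kernel on `𝓕_can(v)` = the
local Kummer condition, from `hker`, the `T_pE`-valued Kummer lift `kummerLiftCocycle` of n1011, §1),
`lambda_clauses_of_interface` (clause (i) of `KatoExpStarFiniteLevelAt W p k t v Λ' Λ_k` verbatim).
§3 (`p = 3`, the crux's binders `Addv W 3`, `3 ∤ c₃`, `#E(ℚ₃)[3] = 1`, `v₃ ∣ 3`):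
`lemmaL_range_three` — **Lemma L (ii)**: from `hdual` and the POINTS side landed by kim3 g12
(`KimAtThreeFineKatoSATPointsRat.forall_norm_mul_padicLog_le_one_iff_three`: the trace-dual of
`log_ω E(ℚ₃)` is `ℤ₃`), `exp*_ω(H¹(ℚ₃, T₃E)) = ℤ₃` EXACTLY (integral, every `3`-adic integer attained);
`tateLocalMap_surjective_three` — `π_{k+1,*}` onto at every depth (`𝓕_can(v₃) = ⊤`, [MR04] Lemma A.1 =
n1011's `propagatedSelmerStructure_three_eq_top_of_torsion_eq_zero`, `t = 0` transported from `ℚ_[3]` as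
in kim3 g10's `forall_torsion_three_eq_zero_adicCompletion_of_natCard_eq_one`); and the deliverable
**`exists_finLevelFunctional_clauses_three`**: `∃ Λfin : ∀ j, H¹(ℚ_{v₃}, E[3^j·3]) →+ ℤ/3^{j+1}` with,
for every `j`, clause (i) of `KatoExpStarFiniteLevelAt W 3 j 0 v₃ Λ Λfin_j` VERBATIM and the interface —
i.e. (C1.b) of ⟨C1⟩ for the witnesses of KIM3-W2-C1-g11 §2, modulo `hker`/`hdual`.  What remains of
⟨C1⟩ after this file: (C1.c) = clause (ii) (LEMMA SAT₀ over the unramified `K_w/ℚ₃`; seats w2-acc4 /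
w2-kport + the semi-local exp*), (C1.a) (Kato's constant, `3 ∤ c_P`), (C1.d) (`ZetaBody` with a DEFINED
`Λ`), the datum `ω_dR`, and the two cite facts.

References: S. Bloch, K. Kato (1990) §3, Prop. 3.8, Def. 3.10, Ex. 3.11 [BlochKato1990]; C.-H. Kim,
AJM 148 (2026) = arXiv:2203.12159v3 §3.3 (Lemma 3.10, Lemma 3.11, Prop. 3.12), §3.4.1, Thm. 3.13
[Kim2022StructureSelmer]; B. Mazur, K. Rubin, Mem. AMS 799 (2004) App. A Lemma A.1 [MazurRubin2004];
K. Rubin, *Euler Systems* (2000) Prop. 1.6.8; J. H. Silverman, *AEC* III.§7, VIII.§2 [SilvermanAEC2009];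
K. Kato, LNM 1553 (1993) Ch. II §1.2 [Kato1993LNM1553]; kim3 memos KIM3-W2-C1-g11 §2.2,
KIM3-W2-C1-SIZING-g12 §1–§2 (HOME=run/shared/lean/pub/bsd-addord/kim3/).
-/

noncomputable section

-- the cell's Theorems namespace `Summit.BirchSwinnertonDyer.BirchSwinnertonDyer.…` repeats the summit name by design (D-0017)
set_option linter.dupNamespace false

open scoped Classical NumberField ContRepresentation
open Field NumberField IsDedekindDomain
open WeierstrassCurve Literature.NumberTheory.EllipticCurves Literature.NumberTheory.GaloisRepresentations
  Literature.NumberTheory.GaloisRepresentations.DiscreteGaloisModule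
open Summit.BirchSwinnertonDyer.Rank1Residual.GaloisImage

open Summit.BirchSwinnertonDyer.BirchSwinnertonDyer.Theorems.KimAtThreeFineKatoLocalExactness

namespace Summit.BirchSwinnertonDyer.BirchSwinnertonDyer.Theorems.KimAtThreeFineKatoLemmaL

/-! ### §2. A finite-level functional `Λ_k` with `Λ_k (π_{k+1,*} y) = exp*_ω(y) mod p^{k+1}` for an
ABSTRACT integral `exp*_ω`: existence, and `KatoExpStarFiniteLevelAt` clause (i) for ANY such `Λ_k` -/

section FiniteLevel

variable (W : WeierstrassCurve ℚ) (p : ℕ) [hp : Fact p.Prime] [W.IsElliptic] (k : ℕ) (v : Place ℚ)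
  (φ : (tateLocalRep W p v).cohomology 1 →+ ℚ_[p])

/-- **Well-definedness of `exp*_ω mod p^{k+1}` on `𝓕_can(v)`**: two `T_pE`-classes with the same
image in `H¹(ℚ_v, E[p^k·p])` differ by `p^{k+1} · H¹(ℚ_v, T_pE)` (§1), so their `exp*_ω`-values, when
`p`-adic integers `s, s'`, agree mod `p^{k+1}` (the value of the difference class is integral: `hint`).
[cite: Kim2022StructureSelmer, §3.3 (Lemma 3.11, Prop. 3.12)] -/
theorem toZModPow_eq_of_tateLocalMap_eq (hint : ∀ y, ‖φ y‖ ≤ 1)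
    {y y' : (tateLocalRep W p v).cohomology 1} (h : tateLocalMap W p k v y = tateLocalMap W p k v y')
    (s s' : ℤ_[p]) (hs : φ y = s) (hs' : φ y' = s') :
    PadicInt.toZModPow (k + 1) s = PadicInt.toZModPow (k + 1) s' := by
  have h0 : tateLocalMap W p k v (y - y') = 0 := by rw [map_sub, h, sub_self]
  obtain ⟨y'', hy''⟩ := exists_eq_zsmul_of_tateLocalMap_eq_zero W p k v (y - y') h0
  set s'' : ℤ_[p] := ⟨φ y'', hint y''⟩ with hs''def
  have hs'' : φ y'' = s'' := rfl
  have hdiff : s - s' = (p : ℤ_[p]) ^ (k + 1) * s'' := by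
    apply PadicInt.ext
    rw [PadicInt.coe_sub, PadicInt.coe_mul, PadicInt.coe_pow, PadicInt.coe_natCast, ← hs, ← hs', ← hs'',
      ← map_sub, hy'', map_zsmul, zsmul_eq_mul, Int.cast_pow, Int.cast_natCast]
  rw [← sub_eq_zero, ← map_sub, hdiff, map_mul, map_pow, map_natCast, ← Nat.cast_pow,
    ZMod.natCast_self, zero_mul]

/-- **Existence of the finite-level functional** `Λ_k : H¹(ℚ_v, E[p^k·p]) →+ ℤ/p^{k+1}` with
`Λ_k (π_{k+1,*} y) = exp*_ω(y) mod p^{k+1}` whenever `exp*_ω(y) ∈ ℤ_p` (`Λ_k := (exp*_ω ∘ lift) mod p^{k+1}`),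
for an abstract INTEGRAL `exp*_ω = φ` (`hint`), when `π_{k+1,*} : H¹(ℚ_v, T_pE) → H¹(ℚ_v, E[p^k·p])` is
ONTO (`𝓕_can(v) = ⊤`; at `v ∣ p = 3` this is `E(ℚ₃)[3] = 0`, [MR04] Lemma A.1) — additive by the
well-definedness lemma.  This is the `Λfin_j` of kim3 memo KIM3-W2-C1-g11 §2 (the witness of the
(P-EXP) rider), and the displayed implication is the interface the proof of clause (ii) / LEMMA SAT₀
consumes ("`Λfin_j(loc κ₀) = exp*_ω(h) mod M` for a lift `h`").
[cite: Kim2022StructureSelmer, §3.3 (Lemma 3.11, Prop. 3.12) and §3.4.1] -/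
theorem exists_functional_tateLocalMap_eq (hint : ∀ y, ‖φ y‖ ≤ 1)
    (hsurj : Function.Surjective (tateLocalMap W p k v)) :
    ∃ Λ : galoisCohomology ((W.torsionGaloisModule ((p : ℤ) ^ k * (p : ℤ))).toLocal v) 1 →+
        ZMod (p ^ (k + 1)),
      ∀ (y : (tateLocalRep W p v).cohomology 1) (s : ℤ_[p]), φ y = s →
        Λ (tateLocalMap W p k v y) = PadicInt.toZModPow (k + 1) s := by
  let ι : (tateLocalRep W p v).cohomology 1 → ℤ_[p] := fun y => ⟨φ y, hint y⟩
  have hι : ∀ y, φ y = ι y := fun y => rfl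
  let F : galoisCohomology ((W.torsionGaloisModule ((p : ℤ) ^ k * (p : ℤ))).toLocal v) 1 →
      ZMod (p ^ (k + 1)) :=
    fun x => PadicInt.toZModPow (k + 1) (ι (Function.surjInv hsurj x))
  have hF : ∀ (y : (tateLocalRep W p v).cohomology 1) (s : ℤ_[p]), φ y = s →
      F (tateLocalMap W p k v y) = PadicInt.toZModPow (k + 1) s :=
    fun y s hs => toZModPow_eq_of_tateLocalMap_eq W p k v φ hint (Function.surjInv_eq hsurj _) _ _
      (hι _) hs
  refine ⟨{ toFun := F, map_zero' := ?_, map_add' := fun x x' => ?_ }, hF⟩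
  · rw [← map_zero (tateLocalMap W p k v), hF 0 0 (by rw [map_zero, PadicInt.coe_zero]), map_zero]
  · obtain ⟨y, rfl⟩ := hsurj x
    obtain ⟨y', rfl⟩ := hsurj x'
    rw [← map_add, hF (y + y') (ι y + ι y') (by rw [map_add, PadicInt.coe_add, hι, hι]),
      hF y (ι y) (hι y), hF y' (ι y') (hι y'), map_add]

variable {Λ : galoisCohomology ((W.torsionGaloisModule ((p : ℤ) ^ k * (p : ℤ))).toLocal v) 1 →+
  ZMod (p ^ (k + 1))}

/-- **Clause (i-a) of `KatoExpStarFiniteLevelAt`** for any `Λ_k` with the interface: `Λ_k` is ONTO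
`ℤ/p^{k+1}` on `𝓕_can(v)` — because `exp*_ω(H¹(ℚ_v, T_pE)) ⊇ ℤ_p` (Lemma L (ii) on the Kato stratum).
[cite: Kim2022StructureSelmer, §3.3 (Lemma 3.11, Prop. 3.12)] -/
theorem exists_mem_propagated_apply_eq
    (hΛ : ∀ (y : (tateLocalRep W p v).cohomology 1) (s : ℤ_[p]), φ y = s →
      Λ (tateLocalMap W p k v y) = PadicInt.toZModPow (k + 1) s)
    (hsurjφ : ∀ s : ℤ_[p], ∃ y, φ y = s) (c : ZMod (p ^ (k + 1))) :
    ∃ x ∈ propagatedSelmerStructure W p k v, Λ x = c := by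
  haveI : NeZero (p ^ (k + 1)) := ⟨pow_ne_zero _ hp.out.ne_zero⟩
  obtain ⟨y, hy⟩ := hsurjφ (c.val : ℤ_[p])
  refine ⟨tateLocalMap W p k v y, (mem_propagatedSelmerStructure_iff W p k v _).mpr ⟨y, rfl⟩, ?_⟩
  rw [hΛ y _ hy, map_natCast, ZMod.natCast_zmod_val]

/-- **Clause (i-b) of `KatoExpStarFiniteLevelAt`** for any `Λ_k` with the interface: on `𝓕_can(v)`
the kernel of `Λ_k` is EXACTLY the local Kummer condition `W.kummerSelmerStructure (p^k·p) v`.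
Inputs: the [BK90] kernel fact in lattice form (`hker`: `exp*_ω(y) = 0` iff every finite-level image
`π_{j+1,*} y` is a local Kummer class — i.e. `ker exp*_ω = H¹_f(ℚ_v, T_pE) = E(ℚ_v) ⊗ ℤ_p`, [BK90]
Prop. 3.8 / Ex. 3.11), integrality (`hint`) and `exp*_ω(H¹) ⊇ ℤ_p` (`hsurjφ`), §1's exactness (through
the interface), the `T_pE`-valued Kummer lift of a local point (`kummerLiftCocycle`) and
`p^k·p · H¹(ℚ_v, E[p^k·p]) = 0`.
[cite: BlochKato1990, §3 (Prop. 3.8, Ex. 3.11)] [cite: Kim2022StructureSelmer, §3.3 (Lemma 3.11, first line)] -/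
theorem apply_eq_zero_iff_mem_kummer (hint : ∀ y, ‖φ y‖ ≤ 1)
    (hΛ : ∀ (y : (tateLocalRep W p v).cohomology 1) (s : ℤ_[p]), φ y = s →
      Λ (tateLocalMap W p k v y) = PadicInt.toZModPow (k + 1) s)
    (hsurjφ : ∀ s : ℤ_[p], ∃ y, φ y = s)
    (hker : ∀ y, φ y = 0 ↔
      ∀ j : ℕ, tateLocalMap W p j v y ∈ W.kummerSelmerStructure ((p : ℤ) ^ j * (p : ℤ)) v)
    (x : galoisCohomology ((W.torsionGaloisModule ((p : ℤ) ^ k * (p : ℤ))).toLocal v) 1)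
    (hx : x ∈ propagatedSelmerStructure W p k v) :
    Λ x = 0 ↔ x ∈ W.kummerSelmerStructure ((p : ℤ) ^ k * (p : ℤ)) v := by
  obtain ⟨y, rfl⟩ := (mem_propagatedSelmerStructure_iff W p k v x).mp hx
  constructor
  · -- `Λ(π y) = 0 ⇒ exp*_ω(y) ∈ p^{k+1} ℤ_p = p^{k+1} exp*_ω(H¹) ⇒ y ∈ ker exp*_ω + p^{k+1} H¹`
    intro h0
    set s : ℤ_[p] := ⟨φ y, hint y⟩ with hsdef
    have hs : φ y = s := rfl
    rw [hΛ y s hs] at h0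
    have hmem : s ∈ RingHom.ker (PadicInt.toZModPow (p := p) (k + 1)) := h0
    rw [PadicInt.ker_toZModPow, Ideal.mem_span_singleton'] at hmem
    obtain ⟨a, ha⟩ := hmem
    obtain ⟨y', hy'⟩ := hsurjφ a
    have hzero : φ (y - ((p : ℤ) ^ (k + 1)) • y') = 0 := by
      have hy : φ y = (a : ℚ_[p]) * (p : ℚ_[p]) ^ (k + 1) := by
        rw [hs, ← ha, PadicInt.coe_mul, PadicInt.coe_pow, PadicInt.coe_natCast]
      rw [map_sub, map_zsmul, hy, hy', zsmul_eq_mul, Int.cast_pow, Int.cast_natCast, mul_comm, sub_self]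
    have hkum := (hker _).mp hzero k
    rwa [map_sub, map_zsmul, pow_succ, pow_zsmul_eq_zero, sub_zero] at hkum
  · -- a Kummer class is `π_{k+1,*}` of the `T_pE`-valued Kummer lift, on which `exp*_ω` vanishes
    intro hx
    rw [kummerSelmerStructure_apply] at hx
    obtain ⟨Q, hQ, hQx⟩ :=
      (W.mem_kummerLocalConditionAt_iff_exists_eq_localKummerClass _ (pow_mul_ne_zero p k) _).mp hx
    set yQ : (tateLocalRep W p v).cohomology 1 :=
      oneCocycleClass (tateLocalRep W p v).toTopRep (kummerLiftCocycle W p v _ hQ) with hyQ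
    have hlift : tateLocalMap W p k v yQ = tateLocalMap W p k v y := by
      rw [hQx, hyQ, tateLocalMap_kummerLiftCocycle]
      apply localKummerClass_eq_of_zsmul_eq
      rw [← pow_succ, pow_zsmul_divSeq, pow_succ]
    have hall : ∀ j : ℕ,
        tateLocalMap W p j v yQ ∈ W.kummerSelmerStructure ((p : ℤ) ^ j * (p : ℤ)) v := by
      intro j
      rw [hyQ, tateLocalMap_kummerLiftCocycle, kummerSelmerStructure_apply]
      exact W.localKummerClass_mem_kummerLocalConditionAt _ _ _ _
    have hφ : φ yQ = 0 := (hker yQ).mpr hall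
    rw [← hlift, hΛ yQ 0 (by rw [hφ, PadicInt.coe_zero]), map_zero]

/-- **Clause (i) of `KatoExpStarFiniteLevelAt W p k t v Λ' Λ_k`, both halves, for any `Λ_k` with the
interface** (the conjunction as the predicate states it; independent of `Λ'` and `t`).
[cite: Kim2022StructureSelmer, §3.3 (Lemma 3.11, Prop. 3.12)] [cite: BlochKato1990, §3 (Prop. 3.8, Ex. 3.11)] -/
theorem lambda_clauses_of_interface (hint : ∀ y, ‖φ y‖ ≤ 1)
    (hΛ : ∀ (y : (tateLocalRep W p v).cohomology 1) (s : ℤ_[p]), φ y = s →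
      Λ (tateLocalMap W p k v y) = PadicInt.toZModPow (k + 1) s)
    (hsurjφ : ∀ s : ℤ_[p], ∃ y, φ y = s)
    (hker : ∀ y, φ y = 0 ↔
      ∀ j : ℕ, tateLocalMap W p j v y ∈ W.kummerSelmerStructure ((p : ℤ) ^ j * (p : ℤ)) v) :
    (∀ c : ZMod (p ^ (k + 1)), ∃ x ∈ propagatedSelmerStructure W p k v, Λ x = c) ∧
    (∀ x ∈ propagatedSelmerStructure W p k v,
        Λ x = 0 ↔ x ∈ W.kummerSelmerStructure ((p : ℤ) ^ k * (p : ℤ)) v) :=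
  ⟨exists_mem_propagated_apply_eq W p k v φ hΛ hsurjφ,
    fun x hx => apply_eq_zero_iff_mem_kummer W p k v φ hint hΛ hsurjφ hker x hx⟩

end FiniteLevel

/-! ### §3. The Kato stratum at `p = 3` in the crux's binders: Lemma L (ii) from the duality fact
and the points side, `𝓕_can(v₃) = ⊤` from `t = 0`, and (C1.b) = clause (i) at EVERY depth -/

section Three

open Summit.BirchSwinnertonDyer.Rank1Residual.Additive.LocalLog
open Literature.NumberTheory.EllipticCurves.Rank1Residual
open Summit.BirchSwinnertonDyer.BirchSwinnertonDyer.Theorems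

variable (W : WeierstrassCurve ℚ) [W.IsElliptic] [W.IsGloballyMinimal]

/-- **Lemma L (ii) on the Kato stratum, from the local-duality fact in LATTICE form**: if the range
of the scalar dual exponential `exp*_ω` on `H¹(ℚ₃, T₃E)` is the trace-dual of `log_ω E(ℚ₃)`
(`hdual` — [BK90] Prop. 3.8 + Tate local duality, `⟨x, δP⟩ = exp*_ω(x) · log_ω(P)`, DISPLAYED), then
on a row with `Addv W 3`, `3 ∤ c₃`, `E(ℚ₃)[3] = 0` it is EXACTLY `ℤ₃`: integral values and every
`3`-adic integer attained (points side = kim3 g12 `forall_norm_mul_padicLog_le_one_iff_three`,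
`log_ω E(ℚ₃) = ℤ₃`). [cite: BlochKato1990, §3 (Prop. 3.8, Ex. 3.11)] [cite: Kim2022StructureSelmer, §3.3 Lemma 3.10 / Lemma 3.11] -/
theorem lemmaL_range_three (hadd : Addv W 3)
    (hc : ¬ 3 ∣ (W.baseChange ℚ_[3]).localTamagawaNumber ℤ_[3])
    (ht : Nat.card {Q : (W.baseChange ℚ_[3]).toAffine.Point // (3 : ℕ) • Q = 0} = 1)
    (v₃ : HeightOneSpectrum (𝓞 ℚ))
    (φ : (tateLocalRep W 3 (Sum.inr v₃)).cohomology 1 →+ ℚ_[3])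
    (hdual : ∀ a : ℚ_[3], (∃ y, φ y = a) ↔
      ∀ P : (W.baseChange ℚ_[3]).toAffine.Point, ‖a * padicLog (W.baseChange ℚ_[3]) P‖ ≤ 1) :
    (∀ y, ‖φ y‖ ≤ 1) ∧ (∀ s : ℤ_[3], ∃ y, φ y = s) := by
  refine ⟨fun y => ?_, fun s => ?_⟩
  · exact (KimAtThreeFineKatoSATPointsRat.forall_norm_mul_padicLog_le_one_iff_three W hadd hc ht
      (φ y)).mp ((hdual (φ y)).mp ⟨y, rfl⟩)
  · exact (hdual (s : ℚ_[3])).mpr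
      ((KimAtThreeFineKatoSATPointsRat.forall_norm_mul_padicLog_le_one_iff_three W hadd hc ht
        (s : ℚ_[3])).mpr s.2)

omit [W.IsElliptic] [W.IsGloballyMinimal] in
/-- `t = 0` transported from `ℚ_[3]` to `ℚ_{v₃}`: if `#E(ℚ₃)[3] = 1` (the crux's `Nat.card` currency)
then every `3`-torsion point of `E(ℚ_{v₃})` is zero (Mathlib's `adicCompletion.padicEquiv`, through
n1011's `LocalTorsion3.natCard_ker_nsmul_adicCompletion_eq_natCard_torsion_padic`; the same lines as
kim3 g10's `KimAtThreeKolyvaginPortShared.forall_torsion_three_eq_zero_adicCompletion_of_natCard_eq_one`,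
re-derived here to keep this file outside the route file's import cone). [folklore] -/
theorem forall_torsion_three_eq_zero_of_natCard_eq_one
    (ht : Nat.card {Q : (W.baseChange ℚ_[3]).toAffine.Point // (3 : ℕ) • Q = 0} = 1)
    (w : HeightOneSpectrum (𝓞 ℚ)) (hw : ((3 : ℕ) : 𝓞 ℚ) ∈ w.asIdeal) :
    ∀ Q : (W.baseChange (w.adicCompletion ℚ)).toAffine.Point, 3 • Q = 0 → Q = 0 := by
  have hw3 : ((Rat.HeightOneSpectrum.primesEquiv w : Nat.Primes) : ℕ) = 3 :=
    primesEquiv_eq_of_natCast_mem Nat.prime_three hw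
  have hker := LocalTorsion3.natCard_ker_nsmul_adicCompletion_eq_natCard_torsion_padic W w hw3 3
  rw [ht] at hker
  have hbot := (AddSubgroup.card_eq_one).mp hker
  intro Q hQ
  have hmem : Q ∈ (nsmulAddMonoidHom 3 : (W.baseChange (w.adicCompletion ℚ)).toAffine.Point →+
      (W.baseChange (w.adicCompletion ℚ)).toAffine.Point).ker := by
    rw [AddMonoidHom.mem_ker, nsmulAddMonoidHom_apply]
    exact hQ
  rw [hbot] at hmem
  exact (AddSubgroup.mem_bot).mp hmem

omit [W.IsGloballyMinimal] in
/-- **`π_{k+1,*} : H¹(ℚ_{v₃}, T₃E) → H¹(ℚ_{v₃}, E[3^k·3])` is ONTO at every depth when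
`#E(ℚ₃)[3] = 1`** (`𝓕_can(v₃) = ⊤`: [MR04] Lemma A.1 along the reduction tower, tree
`propagatedSelmerStructure_three_eq_top_of_torsion_eq_zero`, reductions from
`exists_torsionReduction_three`, `t = 0` transported to `ℚ_{v₃}`). [cite: MazurRubin2004, App. A, Lemma A.1 (p. 79)] -/
theorem tateLocalMap_surjective_three
    (ht : Nat.card {Q : (W.baseChange ℚ_[3]).toAffine.Point // (3 : ℕ) • Q = 0} = 1)
    (v₃ : HeightOneSpectrum (𝓞 ℚ)) (hv₃ : ((3 : ℕ) : 𝓞 ℚ) ∈ v₃.asIdeal) (k : ℕ) :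
    Function.Surjective (tateLocalMap W 3 k (Sum.inr v₃)) := by
  have htower : ∀ j : ℕ,
      ∃ redj : (W.torsionGaloisModule (((3 : ℕ) : ℤ) ^ (j + 1) * ((3 : ℕ) : ℤ))).toContRepresentation →ⁱL
          (W.torsionGaloisModule (((3 : ℕ) : ℤ) ^ j * ((3 : ℕ) : ℤ))).toContRepresentation,
        ∀ y : geomTorsion W (((3 : ℕ) : ℤ) ^ (j + 1) * ((3 : ℕ) : ℤ)),
          ((redj y : geomTorsion W (((3 : ℕ) : ℤ) ^ j * ((3 : ℕ) : ℤ))) : geomPoints W) =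
            ((3 : ℕ) : ℤ) • (y : geomPoints W) := by
    intro j
    obtain ⟨redj, hredj⟩ := exists_torsionReduction_three W j (j + 1)
    refine ⟨redj, fun y => ?_⟩
    rw [hredj, Nat.add_sub_cancel_left, pow_one]
  choose redT hredT using htower
  have htop : propagatedSelmerStructure W 3 k (Sum.inr v₃) = ⊤ :=
    propagatedSelmerStructure_three_eq_top_of_torsion_eq_zero W v₃ hv₃
      (forall_torsion_three_eq_zero_of_natCard_eq_one W ht v₃ hv₃) redT hredT k
  intro x
  have hx : x ∈ propagatedSelmerStructure W 3 k (Sum.inr v₃) := by rw [htop]; exact AddSubgroup.mem_top x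
  exact (mem_propagatedSelmerStructure_iff W 3 k (Sum.inr v₃) x).mp hx

/-- **(C1.b) IN THE KERNEL MODULO THE TWO PRINT FACTS — Lemma L, Galois side, at every depth.**
For `W/ℚ` globally minimal on the Kato stratum of crux `KatoKuriharaPortThreeShared`
(stmt-BirchSwinnertonDyer-19560: `Addv W 3`, `3 ∤ c₃`, `#E(ℚ₃)[3] = 1`; the tower and Manin binders
are not used here), a place `v₃ ∣ 3`, and ANY additive `exp*_ω = φ : H¹(ℚ_{v₃}, T₃W) → ℚ₃` — the
scalar Bloch–Kato dual exponential in the Néron coordinate, i.e. the tree's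
`PeriodRingData.dualExpClassCoord (bdRPeriodRingData hp) (logCyclotomic 3) ρ ω_dR` composed with
`T₃W → V₃W` once the datum `ω_dR` (definition item `defn-EllipticNeronDeRhamClass`) exists; abstract
here — satisfying the two PUBLISHED facts as DISPLAYED hypotheses in lattice form:
`hker` = [BK90] Prop. 3.8 / Ex. 3.11 (`ker exp*_ω = H¹_f(ℚ₃, T₃E) = E(ℚ₃) ⊗ ℤ₃`, read: `exp*_ω(y) = 0`
iff every `π_{j+1,*} y` is a local Kummer class) and `hdual` = Tate local duality + [BK90] 3.8
(`exp*_ω(H¹(ℚ₃, T)) = (log_ω E(ℚ₃))^∨`), THERE IS a family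
`Λfin_j : H¹(ℚ_{v₃}, E[3^j·3]) →+ ℤ/3^{j+1}` (`(exp*_ω ∘ lift) mod 3^{j+1}`, §2)
satisfying, for EVERY `j`: clause (i) of `KatoExpStarFiniteLevelAt W 3 j 0 v₃ Λ Λfin_j` VERBATIM (onto
`ℤ/3^{j+1}` on `𝓕_can(v₃)`; kernel there = `W.kummerSelmerStructure (3^j·3) v₃`) AND the interface
`exp*_ω(y) = s ∈ ℤ₃ ⇒ Λfin_j(π_{j+1,*} y) = s mod 3^{j+1}` that the proof of clause (ii) (LEMMA SAT₀,
clause (C1.c)) consumes. Ours at `p = 3` additive (kim3 memo KIM3-W2-C1-g11 §2.2); nearest print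
[Kim2022StructureSelmer] Lemma 3.11 / Prop. 3.12 at good `p`. Closes nothing by itself.
[cite: BlochKato1990, §3 (Prop. 3.8, Ex. 3.11)] [cite: Kim2022StructureSelmer, §3.3 (Lemma 3.11, Prop. 3.12)]
[cite: MazurRubin2004, App. A, Lemma A.1 (p. 79)] -/
theorem exists_finLevelFunctional_clauses_three (hadd : Addv W 3)
    (hc : ¬ 3 ∣ (W.baseChange ℚ_[3]).localTamagawaNumber ℤ_[3])
    (ht : Nat.card {Q : (W.baseChange ℚ_[3]).toAffine.Point // (3 : ℕ) • Q = 0} = 1)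
    (v₃ : HeightOneSpectrum (𝓞 ℚ)) (hv₃ : ((3 : ℕ) : 𝓞 ℚ) ∈ v₃.asIdeal)
    (φ : (tateLocalRep W 3 (Sum.inr v₃)).cohomology 1 →+ ℚ_[3])
    (hker : ∀ y, φ y = 0 ↔ ∀ j : ℕ, tateLocalMap W 3 j (Sum.inr v₃) y ∈
      W.kummerSelmerStructure (((3 : ℕ) : ℤ) ^ j * ((3 : ℕ) : ℤ)) (Sum.inr v₃))
    (hdual : ∀ a : ℚ_[3], (∃ y, φ y = a) ↔
      ∀ P : (W.baseChange ℚ_[3]).toAffine.Point, ‖a * padicLog (W.baseChange ℚ_[3]) P‖ ≤ 1) :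
    ∃ Λfin : ∀ j : ℕ, galoisCohomology
        ((W.torsionGaloisModule (((3 : ℕ) : ℤ) ^ j * ((3 : ℕ) : ℤ))).toLocal (Sum.inr v₃)) 1 →+
          ZMod (3 ^ (j + 1)),
      (∀ j : ℕ,
        (∀ c : ZMod (3 ^ (j + 1)), ∃ x ∈ propagatedSelmerStructure W 3 j (Sum.inr v₃), Λfin j x = c) ∧
        (∀ x ∈ propagatedSelmerStructure W 3 j (Sum.inr v₃),
          Λfin j x = 0 ↔ x ∈ W.kummerSelmerStructure (((3 : ℕ) : ℤ) ^ j * ((3 : ℕ) : ℤ)) (Sum.inr v₃))) ∧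
      (∀ (j : ℕ) (y : (tateLocalRep W 3 (Sum.inr v₃)).cohomology 1) (s : ℤ_[3]), φ y = s →
        Λfin j (tateLocalMap W 3 j (Sum.inr v₃) y) = PadicInt.toZModPow (j + 1) s) := by
  obtain ⟨hint, hsurjφ⟩ := lemmaL_range_three W hadd hc ht v₃ φ hdual
  have hsurj := tateLocalMap_surjective_three W ht v₃ hv₃
  have hex := fun j => exists_functional_tateLocalMap_eq W 3 j (Sum.inr v₃) φ hint (hsurj j)
  choose Λ hΛ using hex
  exact ⟨Λ, fun j => lambda_clauses_of_interface W 3 j (Sum.inr v₃) φ hint (hΛ j) hsurjφ hker,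
    fun j y s hs => hΛ j y s hs⟩

end Three

end Summit.BirchSwinnertonDyer.BirchSwinnertonDyer.Theorems.KimAtThreeFineKatoLemmaL

end
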